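import Summits.QuantumFields.YangMills.Theorems.HypercubicLimit.Negative.TelescopingGuards
import Summits.QuantumFields.YangMills.Theorems.HypercubicLimit.Negative.NonabelianLoadBearing
import HarnessLib

/-!
# Crux `HypercubicLimit` (stmt-QuantumFields-16154), line `peel-and-disseminate` (c1 seat): the card's input (F) as typed is false

Support file (`--supports stmt-QuantumFields-16154`, registered sub-goal `not_backgroundProductBound_asTyped`).
The idea card `peel-and-disseminate` typed its chessboard input (F) `BackgroundProductBound` universally over
every non-negative shell-local background functional `W`, with the constant `C₂` chosen AFTER `W` but BEFORE the
coupling `β`.  As typed this is false for a trivial reason, recorded here so that the line works with the merged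
statement (F′) instead.

Proof route (witness).  Take any gauge group with a lattice representation — the trivial group `PUnit` with
`punitRep` of `Theorems/HypercubicLimit/Negative/NonabelianLoadBearing.lean` — and `m := 1`, `c₀ := 1`,
`lam := 1`, `C₀ := 0`, `C₁ := 1`, `β₀ := 0`, `W β S R x U := max β 0` (non-negative and constant in `U`, hence
`DependsOn` any link set).  If the conclusion held with constants `C₂, β₂`, choose
`β := max (max 0 β₂) (C₂ + 1)`, get `S₀`, and evaluate at `S := max S₀ 6`, `R := 1`, `n := 1`, `x := 0`
(the separation hypothesis is vacuous on `Fin 1`, the guard `4·1+8 < 2S+1` holds for `S ≥ 6`): the Wilson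
measure is a probability measure (`isProbabilityMeasure_wilsonMeasure`), so the integral of the constant
`∏_{k : Fin 1} (0 + 1 · max β 0) = β` is `β ≤ C₂ ^ 1 = C₂ < β`, a contradiction.
Refs: card `Cruxes/HypercubicLimit/Ideas/peel-and-disseminate.md` (input (F)); JaffeWitten2000 §6. [folklore]
-/

set_option autoImplicit false

noncomputable section

open scoped SchwartzMap ENNReal
open MeasureTheory Filter Topology
open Literature.MathematicalPhysics.AQFT Literature.MathematicalPhysics.QuantumLattice
open Literature.MathematicalPhysics.QuantumFieldTheory
open Literature.Probability.LatticeModels (box Site)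
open Summit.QuantumFields.YangMills.Theorems.HypercubicLimit.Negative
  (torusPlaquette rpSquare influence exterior cubeEdgesT punitRep)

namespace Summit.QuantumFields.YangMills.Cruxes.HypercubicLimit.PeelAndDisseminate

/-- **(F) of the card `peel-and-disseminate` AS TYPED is false** (registered sub-goal
`not_backgroundProductBound_asTyped` of crux stmt-QuantumFields-16154, line `peel-and-disseminate`): with the
constant `C₂` chosen before the coupling `β`, the non-negative, `U`-independent (hence shell-local) background
functional `W β S R x U := max β 0` over the trivial gauge group makes the `n = 1` instance of the product bound
read `β ≤ C₂` for every large `β`, which fails at `β := max (max 0 β₂) (C₂ + 1)`. [folklore] -/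
theorem not_backgroundProductBound_asTyped :
    ¬ (∀ (G : Type) [Group G] [TopologicalSpace G] [IsTopologicalGroup G] [CompactSpace G]
        [MeasurableSpace G] [BorelSpace G] (r : LatticeRep G) (m : ℝ → ℝ) (c₀ : ℝ) (lam : ℕ)
        (C₀ C₁ β₀ : ℝ) (W : ℝ → (S : ℕ) → ℕ → Site 4 → GaugeConfig 4 (2 * S + 1) G → ℝ),
        (∀ β S R x U, 0 ≤ W β S R x U) →
        (∀ β S R x, DependsOn (W β S R x)
          (cubeEdgesT (2 * S + 1) (lam * R + 1) x \ cubeEdgesT (2 * S + 1) (lam * R) x)) →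
          ∃ C₂ β₂ : ℝ, ∀ β : ℝ, max β₀ β₂ ≤ β → ∃ S₀ : ℕ, ∀ S : ℕ, S₀ ≤ S →
            ∀ (R n : ℕ) (x : Fin n → Site 4), 1 ≤ R → (R : ℝ) ≤ c₀ / m β →
              4 * (lam * R) + 8 < 2 * S + 1 →
              (∀ k l, k ≠ l → ∃ μ : Fin 4,
                  (2 * (lam * R) + 3 : ℤ) < |x k μ - x l μ| ∧ |x k μ - x l μ| ≤ S) →
                ∫ U, ∏ k, (C₀ + C₁ * W β S R (x k) U)
                    ∂(wilsonMeasure r.ρ β : Measure (GaugeConfig 4 (2 * S + 1) G)) ≤ C₂ ^ n) := by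
  intro h
  -- the witness: trivial gauge group, `W := max β 0` (non-negative, constant in the configuration)
  obtain ⟨C₂, β₂, hC⟩ := h PUnit punitRep (fun _ => 1) 1 1 0 1 0 (fun β _ _ _ _ => max β 0)
    (fun β _ _ _ _ => le_max_right β 0) (fun _ _ _ _ _ _ _ => rfl)
  -- a coupling above both thresholds and above `C₂`
  set β : ℝ := max (max 0 β₂) (C₂ + 1) with hβ
  have hβC : C₂ + 1 ≤ β := le_max_right _ _
  have hβ0 : max β 0 = β := max_eq_left ((le_max_left 0 β₂).trans (le_max_left _ _))
  obtain ⟨S₀, hS⟩ := hC β (le_max_left _ _)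
  -- evaluate at `S := max S₀ 6`, `R := 1`, `n := 1`, `x := 0`
  have hint := hS (max S₀ 6) (le_max_left _ _) 1 1 (fun _ _ => 0) le_rfl (by norm_num)
    (by have := le_max_right S₀ 6; omega) (fun k l hkl => absurd (Subsingleton.elim k l) hkl)
  haveI := isProbabilityMeasure_wilsonMeasure (d := 4) (L := 2 * max S₀ 6 + 1) punitRep.ρ
    punitRep.continuous β
  simp only [Finset.prod_const, Finset.card_univ, Fintype.card_fin, pow_one, zero_add, one_mul, hβ0,
    integral_const, smul_eq_mul, probReal_univ] at hint
  linarith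

end Summit.QuantumFields.YangMills.Cruxes.HypercubicLimit.PeelAndDisseminate

end
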